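import Summits.ResolutionOfSingularities.ResolutionOfSingularities.Theorems.MarkedTransferCampaignW36SupplyTBHolds
import Literature.AlgebraicGeometry.Resolution.RegularCentreRsopPart
import Literature.AlgebraicGeometry.Resolution.RegularLocalRingsProofs
import Literature.AlgebraicGeometry.Resolution.BlowupChartRsop
import Literature.AlgebraicGeometry.Hironaka2017.Lib.AmbientBlowup
import HarnessLib

/-!
# [OURS · L1 W3.6] «𝒞 ⊇ REGULAR CUTS» — a regular reduced closed cut is A-type AND B-type at each of its points; hence every
# `(E, ed)` whose `Σ̄_max` is regular (W3.1's `CampaignW31.InvmaxClosureRegularOn`) lies in the W3.6 door's class `𝒞`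

Cell `res-hironaka`, rung L, slot W3.6 (class inhabitants; non-vacuity side of the door). Kernel targets K-1 … K-4 of
res-L1-type-o4's NEEDS-KERNEL «𝒞 ⊇ REGULAR CUTS» (HOME/STATUS.md 2026-08-27T04:20:22Z; signatures file
`L/res-L1-type-o4/W36-CLASS-INHABITANTS.sigs.lean` sha16 1ebf1a3f7c37e747), dealt by res-D-plan-1 ROUTING #14 (g) 04:21:01Z.
HOST item stmt-ResolutionOfSingularities-16155 via `--supports` (as every K3.x/W3.x campaign file).

HONEST FRAMING (D-0012/D-0089). Everything here is OURS and folklore commutative algebra about o4's typed classes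
(`CampaignW36.IsLCICutAt`, `IsMonomialCutAt`, `LCIClass`, `MonomialClass`, `LCIOrMonomialClass`, p488503) and W3.1's premise
`CampaignW31.InvmaxClosureRegularOn` (p476257); NOTHING below is a statement of H. Hironaka's manuscript [Hironaka2017] (lit key
`paper:url-3343fd9e678b`), which never reads the geometry of `Σ̄_max` (p.30 l.4–9) — it stays «under review». AI-produced kernel
proofs with standard axioms; weaker than expert review.

WHAT THIS FILE PROVES (signatures VERBATIM from the sigs file).
* K-1 `CampaignW36.isLCICutAt_of_isRegular` — in a locally Noetherian scheme `Z`, a closed `C` whose reduced structure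
  `(vanishingIdeal C).subscheme` is regular is A-TYPE at every `x ∈ C` with regular `𝒪_{Z,x}`: `(𝓘_C)_x` is generated by a part
  `c = (c_1, …, c_r)` of a regular system of parameters (tree `Resolution.exists_isRsopPart_span_range_eq_stalkIdeal_of_mem_closeds`,
  [CoP1] Prop. 4.2), `c` extends to a full r.s.p. `z` (`IsRsopPart.exists_rsop`), `z` is an `𝒪_{Z,x}`-regular sequence
  (`isRegular_of_span_eq_maximalIdeal`, Matsumura 14.2/14.3), and a HEAD of a (weakly) regular sequence is (weakly) regular
  (Mathlib `RingTheory.Sequence.isWeaklyRegular_append_iff`); the `Fin`-family ↔ `List` glue is the tree's `Ideal.ofList_ofFn`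
  (`Resolution/BlowupChartRsop`).
* K-2 `CampaignW36.isMonomialCutAt_of_isRegular` — the same `C` is B-TYPE at `x`: in the r.s.p. `z` (row 004b's `IsRSP`),
  `(𝓘_C)_x = span (z '' S₀)` for the single coordinate subset `S₀ = {1, …, r}`.
* K-3a/3b/3 `lciClass_/monomialClass_/lciOrMonomialClass_of_invmaxClosureRegularOn` — on an ambient datum `A` (every stalk of
  `A.Z` regular, `IsAmbient.isRegular`; locally Noetherian, `IsAmbient.isLocallyNoetherian`), `Σ̄_max` REGULAR ⇒ the `Inv_max`-stratum
  is in the A-type class, the B-type class, and the door's class `𝒞` (`CampaignW31.invmaxClosure S f = Closeds.closure (invmaxStratum S f)`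
  is `rfl`).
* K-4 (example, class level): at any `(E, ed)` with `Σ̄_max(Ê)` regular the class guard of `CoreFocusExistsOn LCIOrMonomialClass` holds —
  the W3.1 regular-residual door sits INSIDE the W3.6 door.

## References (context; nothing below is used as a premise)
* V. Cossart, O. Piltant, J. Algebra 320 (2008), proof of Prop. 4.2 (regular centre = part of an r.s.p.; tree
  `RegularCentreRsopPart.lean`). [cite: CossartPiltant2008, proof of Prop. 4.2]
* H. Matsumura, Commutative Ring Theory (1987), Thms. 14.2, 14.3 (an r.s.p. is a regular sequence; tree
  `RegularLocalRingsProofs.isRegular_of_span_eq_maximalIdeal`). [cite: Matsumura1987, Thms. 14.2, 14.3]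
* H. Hironaka, ms. 2017-03-23, §6.2 p.30 l.4–9 — scope only, under adjudication. [Hironaka2017]
* Cell records: res-L1-type-o4 NEEDS-KERNEL 04:20:22Z; res-D-plan-1 ROUTING #14 (g) 04:21:01Z; o4 p488503 (classes), p476257 (W3.1
  `InvmaxClosureRegularOn`).
-/

noncomputable section

set_option linter.dupNamespace false -- mandated namespace of this single-conjunct summit

open _root_.AlgebraicGeometry _root_.TopologicalSpace _root_.CategoryTheory _root_.IsLocalRing

namespace Summit.ResolutionOfSingularities.ResolutionOfSingularities.Theorems

open Literature.AlgebraicGeometry.Resolution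
open Literature.AlgebraicGeometry.Hironaka2017
open Literature.AlgebraicGeometry.Hironaka2017.S02Preliminaries
open Literature.AlgebraicGeometry.Hironaka2017.S04CharAlgebra
open Literature.AlgebraicGeometry.Hironaka2017.S06BaseHike
open Literature.AlgebraicGeometry.Hironaka2017.Datum
open Scheme.IdealSheafData

universe u

namespace CampaignW36

/-! ## Ring-level plumbing: a part of a regular system of parameters is a regular sequence -/

section Ring

variable {R : Type u} [CommRing R] [IsLocalRing R]

/-- **A part of a regular system of parameters of a regular local ring is an `R`-regular sequence** (in the LIST form of
Mathlib's `RingTheory.Sequence.IsRegular`): extend `c` to a full r.s.p. `z` (`IsRsopPart.exists_rsop`), which is a regular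
sequence (Matsumura 14.2/14.3, tree `isRegular_of_span_eq_maximalIdeal`), and take the head (`isWeaklyRegular_append_iff`); the
ideal `(c)` is proper since it lies in the maximal ideal. [cite: Matsumura1987, Thms. 14.2, 14.3] -/
theorem isRegular_ofFn_of_isRsopPart {r : ℕ} {c : Fin r → R} (hc : IsRsopPart c) :
    RingTheory.Sequence.IsRegular R (List.ofFn c) := by
  classical
  haveI : IsRegularLocalRing R := hc.1
  obtain ⟨e, z, hfin, hzspan, hzc⟩ := hc.exists_rsop
  -- the full system `z` is an `R`-regular sequence
  have hlen : ((List.ofFn z).length : WithBot ℕ∞) = ringKrullDim R := by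
    rw [List.length_ofFn, ← hfin]
    exact (isRegularLocalRing_iff R).mp inferInstance
  have hreg : RingTheory.Sequence.IsRegular R (List.ofFn z) :=
    isRegular_of_span_eq_maximalIdeal R _ (by rw [Ideal.ofList_ofFn, hzspan]) hlen
  -- `z = Fin.append c t` with `t` the tail
  have hz : z = Fin.append c (fun j => z (Fin.natAdd r j)) := by
    ext i
    induction i using Fin.addCases with
    | left j => rw [Fin.append_left, hzc]
    | right j => rw [Fin.append_right]
  have hw : RingTheory.Sequence.IsWeaklyRegular R (List.ofFn c) := by
    have h := hreg.toIsWeaklyRegular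
    rw [hz, List.ofFn_fin_append] at h
    exact ((RingTheory.Sequence.isWeaklyRegular_append_iff R _ _).mp h).1
  -- the members of `c` lie in the maximal ideal, so `(c) ≠ R`
  have hle : Ideal.span (Set.range c) ≤ maximalIdeal R := by
    rw [← hzspan]
    refine Ideal.span_mono ?_
    rintro _ ⟨i, rfl⟩
    exact ⟨Fin.castAdd e i, hzc i⟩
  refine ⟨hw, ?_⟩
  rw [smul_eq_mul, Ideal.mul_top, Ideal.ofList_ofFn]
  exact fun h => (maximalIdeal.isMaximal R).ne_top (top_le_iff.mp (h.le.trans hle))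

end Ring

/-! ## K-1 / K-2: a REGULAR reduced closed cut is A-type and B-type at each of its points -/

section Cuts

variable {Z : Scheme.{u}} [IsLocallyNoetherian Z]

/-- **K-1 [OURS · L1 W3.6]: a REGULAR reduced closed cut is A-type at each of its points (regular ambient stalk)** — replaces the
role of nothing printed; NOT a statement of the manuscript. If the reduced structure `(vanishingIdeal C).subscheme` of the closed
`C ⊆ Z` is a regular scheme and `𝒪_{Z,x}` is regular, then `(𝓘_C)_x` is generated by a regular sequence: by [CoP1] Prop. 4.2 (tree
`exists_isRsopPart_span_range_eq_stalkIdeal_of_mem_closeds`) it is generated by a part of a regular system of parameters, and such a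
part is a regular sequence (`isRegular_ofFn_of_isRsopPart`). [folklore] -/
theorem isLCICutAt_of_isRegular (C : Closeds Z)
    (hC : Scheme.IsRegular (vanishingIdeal C).subscheme) {x : Z} [IsRegularLocalRing (Z.presheaf.stalk x)]
    (hx : x ∈ (C : Set Z)) : IsLCICutAt C x := by
  obtain ⟨r, c, hc, hspan⟩ := exists_isRsopPart_span_range_eq_stalkIdeal_of_mem_closeds hC hx
  exact ⟨List.ofFn c, isRegular_ofFn_of_isRsopPart hc, by rw [Ideal.ofList_ofFn, hspan]⟩

/-- **K-2 [OURS · L1 W3.6]: a REGULAR reduced closed cut is B-type at each of its points (one coordinate ideal of an r.s.p.)** —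
replaces the role of nothing printed; NOT a statement of the manuscript. With `c` as in K-1 extended to a full regular system of
parameters `z = (c, t)` of `𝒪_{Z,x}` (`IsRsopPart.exists_rsop`; row 004b's `IsRSP`), `(𝓘_C)_x = span (z '' S₀)` for the single
coordinate subset `S₀ = castAdd (Fin r) ⊆ Fin (r + e)`. [folklore] -/
theorem isMonomialCutAt_of_isRegular (C : Closeds Z)
    (hC : Scheme.IsRegular (vanishingIdeal C).subscheme) {x : Z} [IsRegularLocalRing (Z.presheaf.stalk x)]
    (hx : x ∈ (C : Set Z)) : IsMonomialCutAt C x := by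
  classical
  obtain ⟨r, c, hc, hspan⟩ := exists_isRsopPart_span_range_eq_stalkIdeal_of_mem_closeds hC hx
  obtain ⟨e, z, hfin, hzspan, hzc⟩ := hc.exists_rsop
  refine ⟨r + e, z, ⟨inferInstance, hzspan, hfin⟩, {Finset.univ.map (Fin.castAddEmb e)}, ?_⟩
  rw [Finset.iInf_singleton, ← hspan]
  congr 1
  ext a
  simp only [Finset.coe_map, Finset.coe_univ, Set.image_univ, Set.mem_image, Set.mem_range,
    Fin.coe_castAddEmb]
  constructor
  · rintro ⟨i, rfl⟩
    exact ⟨Fin.castAdd e i, ⟨i, rfl⟩, hzc i⟩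
  · rintro ⟨_, ⟨i, rfl⟩, rfl⟩
    exact ⟨i, (hzc i).symm⟩

end Cuts

/-! ## K-3: on an ambient datum, `Σ̄_max` REGULAR ⇒ A-type class, B-type class, the door's class `𝒞` -/

section Classes

variable {p : ℕ} [Fact p.Prime] {K : Type u} [Field K] [CharP K p]

/-- **K-3a [OURS · L1 W3.6]: `Σ̄_max` REGULAR (W3.1's `CampaignW31.InvmaxClosureRegularOn`, p476257) ⇒ A-type class** — replaces the
role of nothing printed; NOT a statement of the manuscript. Every stalk of an ambient scheme is regular (`IsAmbient.isRegular`) and the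
scheme is locally Noetherian (`IsAmbient.isLocallyNoetherian`), so K-1 applies at every point of `Σ̄_max = closure (invmaxStratum S f)`
(`CampaignW31.invmaxClosure S f` is that `Closeds.closure` by `rfl`). [folklore] -/
theorem lciClass_of_invmaxClosureRegularOn (A : AmbientDatum p K) {n : ℕ} (F : IdealExponent A.Z) (S : Set A.Z)
    (f : A.Z → EdgeInv n) (h : CampaignW31.InvmaxClosureRegularOn S f) : LCIClass F (invmaxStratum S f) := by
  have hamb : IsAmbient p A.hom := ⟨(Fact.out : p.Prime).pos, A.irreducible, A.smooth, A.quasiCompact⟩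
  haveI : IsLocallyNoetherian A.Z := hamb.isLocallyNoetherian
  intro x hx
  haveI : IsRegularLocalRing (A.Z.presheaf.stalk x) := hamb.isRegular x
  exact isLCICutAt_of_isRegular (Closeds.closure (invmaxStratum S f)) h hx

/-- **K-3b [OURS · L1 W3.6]: `Σ̄_max` REGULAR ⇒ B-type class** — replaces the role of nothing printed; NOT a statement of the
manuscript; K-2 at every point of `Σ̄_max`. [folklore] -/
theorem monomialClass_of_invmaxClosureRegularOn (A : AmbientDatum p K) {n : ℕ} (F : IdealExponent A.Z) (S : Set A.Z)
    (f : A.Z → EdgeInv n) (h : CampaignW31.InvmaxClosureRegularOn S f) : MonomialClass F (invmaxStratum S f) := by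
  have hamb : IsAmbient p A.hom := ⟨(Fact.out : p.Prime).pos, A.irreducible, A.smooth, A.quasiCompact⟩
  haveI : IsLocallyNoetherian A.Z := hamb.isLocallyNoetherian
  intro x hx
  haveI : IsRegularLocalRing (A.Z.presheaf.stalk x) := hamb.isRegular x
  exact isMonomialCutAt_of_isRegular (Closeds.closure (invmaxStratum S f)) h hx

/-- **K-3 [OURS · L1 W3.6]: `Σ̄_max` REGULAR ⇒ the door's class `𝒞`** (A-type everywhere ⇒ 𝒞, o4's `lciClass_le`) — replaces the role of
nothing printed; NOT a statement of the manuscript. [folklore] -/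
theorem lciOrMonomialClass_of_invmaxClosureRegularOn (A : AmbientDatum p K) {n : ℕ} (F : IdealExponent A.Z) (S : Set A.Z)
    (f : A.Z → EdgeInv n) (h : CampaignW31.InvmaxClosureRegularOn S f) : LCIOrMonomialClass F (invmaxStratum S f) :=
  lciClass_le F _ (lciClass_of_invmaxClosureRegularOn A F S f h)

end Classes

end CampaignW36

/-- **K-4 (payoff, class level) [OURS · L1 W3.6]: the W3.1 regular-residual door is INSIDE the W3.6 door** — on every ambient datum,
every `(E, ed)` with `Σ̄_max(Ê)` regular (`CampaignW31.InvmaxClosureRegularOn` on `Sing(Ê)_cl` for the `Inv`-field of `ed`) satisfies the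
class guard of `CampaignW36.CoreFocusExistsOn LCIOrMonomialClass` (so `HatClosureRegularPos ⇒ U30_2_R2_inst` is a corollary of the binder-free
door p494780). Replaces the role of nothing printed; NOT a statement of the manuscript. [folklore] -/
example {p : ℕ} [Fact p.Prime] {K : Type u} [Field K] [CharP K p] [PerfectField K] (A : AmbientDatum p K) (n : ℕ)
    (E : IdealExponent A.Z) (ed : EdgeDataOn p n (baseHike E))
    (hreg : CampaignW31.InvmaxClosureRegularOn ((baseHike E).sing ∩ S02Preliminaries.closedPoints A.Z)
      (invField (baseHike E) ed)) :
    CampaignW36.LCIOrMonomialClass (baseHike E)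
      (invmaxStratum ((baseHike E).sing ∩ S02Preliminaries.closedPoints A.Z) (invField (baseHike E) ed)) :=
  CampaignW36.lciOrMonomialClass_of_invmaxClosureRegularOn A (baseHike E) _ _ hreg

end Summit.ResolutionOfSingularities.ResolutionOfSingularities.Theorems

end
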